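import Summits.Parity.GeneralizedHardyLittlewood.Theorems.LiouvilleShiftedTablesMAvgSquarefree

/-!
# `MAvg` from an `ℓ¹`-level statement for `λ` against `Λ` (SieveToMAvg, step (i))

Route `LiouvilleShiftedTables`, item `MAvg` (stmt-Parity-14273). Two sufficient conditions, each
the natural output of the route's sieve glue `SieveToMAvg` (stmt-Parity-14274: Heath-Brown identity
on `Λ`, Type I from `BVLiouville`, Type I₂ from `TypeI2Dilated`, Type II from `DilatedTableChowla`):

* `MAvg_of_isLittleO_sum_abs_liouvilleSlices` — cofactor form: if for every `h ≥ 1` there is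
  `ε > 0` with `∑_{q ≤ x^{2ε}} |∑_{e ≤ x/q} λ(e) Λ(e q + h)| = o(x/(log x)^5)`, then `MAvg`.
  (Master inequality of `…MAvgSquarefree` with `K = ⌊(log x)^4⌋`: the dilations `k ≤ K` cost
  `ε (log x)^5 · o(x/(log x)^5)`, the tail `≤ 4ε x (1 + ε log x)/(log x)^2`.)
* `MAvg_of_isLittleO_sum_abs_vonMangoldt_mul_liouville_progressions` — progression form
  `∑_{q ≤ X^{2ε}} |T(X; q, h)| = o(X/(log X)^5)`, `T(X; q, h) := ∑_{h < n ≤ X, n ≡ h (q)} Λ(n) λ(n − h)`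
  (the display of the `SieveToMAvg` docstring, which asks for `≪ X/(log X)^6`), via the
  substitution `n = e q + h`, `λ(n − h) = λ(q) λ(e)` (`liouvilleSlice_eq_liouville_mul_sum_progression`)
  and `|λ(q)| ≤ 1` at the height `X = x + h`.

* `MAvg_of_sum_abs_vonMangoldt_mul_liouville_progressions_le` — the `≪ X/(log X)^A` form, any
  fixed `A > 5` (the glue's docstring asks for `A = 6`).

So the glue must save `(log X)^{3+}` over the trivial size `≍ ε X (log X)^2` of the `ℓ¹`-sum over
`q ≤ X^{2ε}`. These are reductions (the hypotheses are parity-strength statements, open), landed as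
supports of the item; `MAvg` itself is Bombieri's level-1 residual (open problem).
-/

open Filter Asymptotics Finset

namespace Summit.Parity.GeneralizedHardyLittlewood.Theorems.MAvg

open ArithmeticFunction
open scoped ArithmeticFunction.Moebius ArithmeticFunction.Omega

/-- **`MAvg` from an `ℓ¹`-level statement for `λ` against `Λ` on dilated shifted primes
(SieveToMAvg, step (i)).** If for every shift `h ≥ 1` there is `ε > 0` with
`∑_{q ≤ x^{2ε}} |∑_{e ≤ x/q} λ(e) Λ(e q + h)| = o(x / (log x)^5)` as `x → ∞`,
then `MAvg` holds (with the same `ε` for each `h`). Proof: the master inequality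
`sum_log_mul_abs_moebiusSlice_le` with the cut-off `K = ⌊(log x)^4⌋` (admissible once
`(log x)^8 x^ε ≤ x^{2ε}`): the dilations `k ≤ K` cost `ε (log x)^5 · o(x/(log x)^5) = o(x)` and the
tail `k > K` costs `≤ 4ε x (1 + ε log x)/(log x)^2 = o(x)` (using `log (x + h) ≤ 2 log x`). -/
theorem MAvg_of_isLittleO_sum_abs_liouvilleSlices
    (H : ∀ h : ℕ, 1 ≤ h → ∃ ε : ℝ, 0 < ε ∧
      (fun x : ℝ => ∑ q ∈ Icc 1 ⌊x ^ (2 * ε)⌋₊,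
          |∑ e ∈ Icc 1 ⌊x / q⌋₊, (liouville e : ℝ) * Λ (e * q + h)|)
        =o[atTop] fun x : ℝ => x / Real.log x ^ 5) :
    Summit.Parity.GeneralizedHardyLittlewood.Theses.LiouvilleShiftedTables.MAvg := by
  intro h hh
  obtain ⟨ε, hε, hG⟩ := H h hh
  refine ⟨ε, hε, ?_⟩
  set G : ℝ → ℝ := fun x => ∑ q ∈ Icc 1 ⌊x ^ (2 * ε)⌋₊,
      |∑ e ∈ Icc 1 ⌊x / q⌋₊, (liouville e : ℝ) * Λ (e * q + h)| with hGdef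
  set s : ℝ → ℝ := fun x => 4 * ε * (Real.log x ^ 2)⁻¹ + 4 * ε ^ 2 * (Real.log x)⁻¹ with hsdef
  have hh' : (1 : ℝ) ≤ h := by exact_mod_cast hh
  -- (a) `(log x)^8 x^ε ≤ x^{2ε}` eventually.
  have ev1 : ∀ᶠ x : ℝ in atTop, Real.log x ^ 8 * x ^ ε ≤ x ^ (2 * ε) := by
    have hlo := (isLittleO_log_rpow_rpow_atTop ((8 : ℕ) : ℝ) hε).def one_pos
    filter_upwards [hlo, eventually_ge_atTop (1 : ℝ)] with x hx hx1
    have hx0 : 0 < x := by linarith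
    rw [one_mul, Real.rpow_natCast, Real.norm_of_nonneg (pow_nonneg (Real.log_nonneg hx1) _),
      Real.norm_of_nonneg (Real.rpow_nonneg hx0.le _)] at hx
    rw [two_mul, Real.rpow_add hx0]
    exact mul_le_mul_of_nonneg_right hx (Real.rpow_nonneg hx0.le ε)
  -- (b) `log (x + h) ≤ 2 log x` eventually.
  have ev2 : ∀ᶠ x : ℝ in atTop, Real.log (x + h) ≤ 2 * Real.log x := by
    filter_upwards [eventually_ge_atTop (max 2 (h : ℝ))] with x hx
    have hx2 : (2 : ℝ) ≤ x := le_trans (le_max_left _ _) hx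
    have hxh : (h : ℝ) ≤ x := le_trans (le_max_right _ _) hx
    calc Real.log (x + h) ≤ Real.log (x ^ 2) :=
          Real.log_le_log (by linarith) (by nlinarith)
      _ = 2 * Real.log x := by rw [Real.log_pow]; norm_num
  -- (c) the pointwise bound.
  have key : ∀ᶠ x : ℝ in atTop,
      ∑ m ∈ Icc 1 ⌊x ^ ε⌋₊, Real.log m * |∑ d ∈ Icc 1 ⌊x / m⌋₊, (μ d : ℝ) * Λ (d * m + h)|
        ≤ ε * Real.log x ^ 5 * G x + x * s x := by
    filter_upwards [ev1, ev2, eventually_ge_atTop (3 : ℝ)] with x hx1 hx2 hx3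
    have hx1' : 1 ≤ x := by linarith
    have hx0 : 0 < x := by linarith
    have hlog1 : 1 ≤ Real.log x := Literature.NumberTheory.LFunctions.LiouvilleSum.one_le_log hx3
    set L := Real.log x with hL
    have hL0 : 0 < L := by linarith
    set K := ⌊L ^ 4⌋₊ with hKdef
    have hKle : (K : ℝ) ≤ L ^ 4 := Nat.floor_le (by positivity)
    have hKge : L ^ 4 ≤ (K : ℝ) + 1 := (Nat.lt_floor_add_one _).le
    have hK : K ^ 2 * ⌊x ^ ε⌋₊ ≤ ⌊x ^ (2 * ε)⌋₊ := by
      refine Nat.le_floor ?_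
      push_cast
      calc (K : ℝ) ^ 2 * ⌊x ^ ε⌋₊ ≤ (L ^ 4) ^ 2 * x ^ ε :=
            mul_le_mul (pow_le_pow_left₀ (Nat.cast_nonneg _) hKle 2)
              (Nat.floor_le (Real.rpow_nonneg hx0.le ε)) (Nat.cast_nonneg _) (by positivity)
        _ = L ^ 8 * x ^ ε := by ring
        _ ≤ x ^ (2 * ε) := hx1
    have hGnn : 0 ≤ G x := Finset.sum_nonneg (fun _ _ => abs_nonneg _)
    have hA : ε * L * (K * G x) ≤ ε * L ^ 5 * G x := by
      have h1 : (K : ℝ) * G x ≤ L ^ 4 * G x := mul_le_mul_of_nonneg_right hKle hGnn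
      calc ε * L * (K * G x) ≤ ε * L * (L ^ 4 * G x) :=
            mul_le_mul_of_nonneg_left h1 (by positivity)
        _ = ε * L ^ 5 * G x := by ring
    have hB : ε * L * (x * Real.log (x + h) * (1 + ε * L) * (2 / (K + 1))) ≤ x * s x := by
      have h2K : 2 / ((K : ℝ) + 1) ≤ 2 / L ^ 4 :=
        div_le_div_of_nonneg_left (by norm_num) (by positivity) hKge
      have hlogxh : 0 ≤ Real.log (x + h) := Real.log_nonneg (by linarith)
      calc ε * L * (x * Real.log (x + h) * (1 + ε * L) * (2 / (K + 1)))
          ≤ ε * L * (x * (2 * L) * (1 + ε * L) * (2 / L ^ 4)) := by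
            apply mul_le_mul_of_nonneg_left _ (by positivity)
            apply mul_le_mul _ h2K (by positivity) (by positivity)
            apply mul_le_mul_of_nonneg_right _ (by positivity)
            exact mul_le_mul_of_nonneg_left hx2 hx0.le
        _ = x * s x := by
            simp only [hsdef]
            rw [← hL]
            field_simp
            ring
    calc ∑ m ∈ Icc 1 ⌊x ^ ε⌋₊, Real.log m * |∑ d ∈ Icc 1 ⌊x / m⌋₊, (μ d : ℝ) * Λ (d * m + h)|
        ≤ ε * L * (K * G x + x * Real.log (x + h) * (1 + ε * L) * (2 / (K + 1))) :=
          sum_log_mul_abs_moebiusSlice_le hx1' hε hh hK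
      _ = ε * L * (K * G x) + ε * L * (x * Real.log (x + h) * (1 + ε * L) * (2 / (K + 1))) := by
          ring
      _ ≤ ε * L ^ 5 * G x + x * s x := add_le_add hA hB
  -- (d) both comparison terms are `o(x)`.
  have hGo : (fun x => ε * Real.log x ^ 5 * G x) =o[atTop] fun x : ℝ => x := by
    have h2 : (fun x : ℝ => ε * Real.log x ^ 5 * (x / Real.log x ^ 5)) =O[atTop] fun x : ℝ => x := by
      refine IsBigO.of_bound ε ?_
      filter_upwards [eventually_gt_atTop (1 : ℝ)] with x hx
      have hlog : Real.log x ≠ 0 := (Real.log_pos hx).ne'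
      have h3 : ε * Real.log x ^ 5 * (x / Real.log x ^ 5) = ε * x := by
        field_simp
      rw [h3, Real.norm_eq_abs, Real.norm_eq_abs, abs_mul, abs_of_pos hε]
    exact ((isBigO_refl (fun x => ε * Real.log x ^ 5) atTop).mul_isLittleO hG).trans_isBigO h2
  have hso : (fun x => x * s x) =o[atTop] fun x : ℝ => x := by
    have hs0 : Tendsto s atTop (nhds 0) := by
      have t1 : Tendsto (fun x : ℝ => (Real.log x ^ 2)⁻¹) atTop (nhds 0) :=
        ((tendsto_pow_atTop two_ne_zero).comp Real.tendsto_log_atTop).inv_tendsto_atTop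
      have t2 : Tendsto (fun x : ℝ => (Real.log x)⁻¹) atTop (nhds 0) :=
        Real.tendsto_log_atTop.inv_tendsto_atTop
      have t3 := (t1.const_mul (4 * ε)).add (t2.const_mul (4 * ε ^ 2))
      rw [mul_zero, mul_zero, add_zero] at t3
      exact t3
    have hs1 : s =o[atTop] (fun _ : ℝ => (1 : ℝ)) := (isLittleO_one_iff ℝ).mpr hs0
    have h4 := (isBigO_refl (fun x : ℝ => x) atTop).mul_isLittleO hs1
    simpa only [mul_one] using h4
  -- (e) conclude.
  refine IsBigO.trans_isLittleO ?_ (hGo.add hso)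
  refine IsBigO.of_bound 1 ?_
  filter_upwards [key] with x hx
  rw [one_mul, Real.norm_of_nonneg (Finset.sum_nonneg (fun m _ =>
    mul_nonneg (Real.log_natCast_nonneg m) (abs_nonneg _)))]
  exact hx.trans (Real.le_norm_self _)

/-- From cofactors to the progression: for `q ≥ 1` (and any real `x`; both sides vanish for `x < 1`),
`∑_{e ≤ x/q} λ(e) Λ(e q + h) = λ(q) · ∑_{h < n ≤ ⌊x⌋ + h, n ≡ h (mod q)} Λ(n) λ(n - h)`
(substitute `n = e q + h` and use `λ(n - h) = λ(e) λ(q)`, `λ(q)² = 1`). -/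
theorem liouvilleSlice_eq_liouville_mul_sum_progression (x : ℝ) {q : ℕ} (hq : 1 ≤ q) (h : ℕ) :
    ∑ e ∈ Icc 1 ⌊x / q⌋₊, (liouville e : ℝ) * Λ (e * q + h)
      = (liouville q : ℝ) * ∑ n ∈ (Ioc h (⌊x⌋₊ + h)).filter (fun n => n ≡ h [MOD q]),
          Λ n * (liouville (n - h) : ℝ) := by
  rw [Finset.mul_sum]
  have hq0 : 0 < q := hq
  have hq1 : (liouville q : ℝ) ^ 2 = 1 := by
    rw [liouville_apply (show q ≠ 0 by omega)]
    push_cast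
    rw [← pow_mul, mul_comm, pow_mul, neg_one_sq, one_pow]
  refine Finset.sum_nbij' (fun e => e * q + h) (fun n => (n - h) / q) ?_ ?_ ?_ ?_ ?_
  · intro e he
    rw [mem_Icc] at he
    rw [mem_filter, mem_Ioc]
    have he2 : e * q ≤ ⌊x⌋₊ := by
      have he' := he.2
      rw [Nat.floor_div_natCast] at he'
      exact (Nat.le_div_iff_mul_le hq0).mp he'
    have hpos : 0 < e * q := Nat.mul_pos (by omega) hq0
    refine ⟨⟨by omega, by omega⟩, ?_⟩
    unfold Nat.ModEq
    rw [Nat.add_mod, Nat.mul_mod_left, zero_add, Nat.mod_mod]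
  · intro n hn
    rw [mem_filter, mem_Ioc] at hn
    obtain ⟨⟨hn1, hn2⟩, hn3⟩ := hn
    have hdvd : q ∣ n - h := (Nat.modEq_iff_dvd' hn1.le).mp hn3.symm
    rw [mem_Icc]
    constructor
    · refine (Nat.le_div_iff_mul_le hq0).mpr ?_
      rw [one_mul]
      exact Nat.le_of_dvd (by omega) hdvd
    · rw [Nat.floor_div_natCast]
      exact Nat.div_le_div_right (by omega)
  · intro e _
    simp only [Nat.add_sub_cancel, Nat.mul_div_cancel _ hq0]
  · intro n hn
    rw [mem_filter, mem_Ioc] at hn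
    obtain ⟨⟨hn1, _⟩, hn3⟩ := hn
    have hdvd : q ∣ n - h := (Nat.modEq_iff_dvd' hn1.le).mp hn3.symm
    simp only [Nat.div_mul_cancel hdvd]
    omega
  · intro e _
    simp only [Nat.add_sub_cancel, liouville_apply_mul]
    push_cast
    linear_combination (-((liouville e : ℝ) * Λ (e * q + h))) * hq1

/-- **`MAvg` from an `ℓ¹`-level statement for `Λ(n) λ(n - h)` in the progressions `n ≡ h (mod q)`,
`q ≤ X^{2ε}`** — the form `∑_{q ≤ X^{2ε}} |T(X; q, h)| = o(X/(log X)^5)`,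
`T(X; q, h) := ∑_{h < n ≤ X, n ≡ h (mod q)} Λ(n) λ(n - h)`, in which the route's `SieveToMAvg` plan
(Heath-Brown identity on `Λ`, Types I/I₂/II) states its target. Reduced to
`MAvg_of_isLittleO_sum_abs_liouvilleSlices` at the height `X = x + h` via
`liouvilleSlice_eq_liouville_mul_sum_progression` and `|λ(q)| ≤ 1`. -/
theorem MAvg_of_isLittleO_sum_abs_vonMangoldt_mul_liouville_progressions
    (H : ∀ h : ℕ, 1 ≤ h → ∃ ε : ℝ, 0 < ε ∧
      (fun X : ℝ => ∑ q ∈ Icc 1 ⌊X ^ (2 * ε)⌋₊,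
          |∑ n ∈ (Ioc h ⌊X⌋₊).filter (fun n => n ≡ h [MOD q]),
            Λ n * (liouville (n - h) : ℝ)|)
        =o[atTop] fun X : ℝ => X / Real.log X ^ 5) :
    Summit.Parity.GeneralizedHardyLittlewood.Theses.LiouvilleShiftedTables.MAvg := by
  refine MAvg_of_isLittleO_sum_abs_liouvilleSlices (fun h hh => ?_)
  obtain ⟨ε, hε, hT⟩ := H h hh
  refine ⟨ε, hε, ?_⟩
  have h0 : (0 : ℝ) ≤ h := Nat.cast_nonneg h
  set GT : ℝ → ℝ := fun X => ∑ q ∈ Icc 1 ⌊X ^ (2 * ε)⌋₊,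
      |∑ n ∈ (Ioc h ⌊X⌋₊).filter (fun n => n ≡ h [MOD q]), Λ n * (liouville (n - h) : ℝ)|
    with hGT
  -- pointwise comparison at the height `x + h`
  have hle : ∀ x : ℝ, 0 ≤ x →
      ∑ q ∈ Icc 1 ⌊x ^ (2 * ε)⌋₊, |∑ e ∈ Icc 1 ⌊x / q⌋₊, (liouville e : ℝ) * Λ (e * q + h)|
        ≤ GT (x + h) := by
    intro x hx
    simp only [hGT]
    rw [Nat.floor_add_natCast hx]
    calc ∑ q ∈ Icc 1 ⌊x ^ (2 * ε)⌋₊, |∑ e ∈ Icc 1 ⌊x / q⌋₊, (liouville e : ℝ) * Λ (e * q + h)|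
        ≤ ∑ q ∈ Icc 1 ⌊x ^ (2 * ε)⌋₊,
            |∑ n ∈ (Ioc h (⌊x⌋₊ + h)).filter (fun n => n ≡ h [MOD q]),
              Λ n * (liouville (n - h) : ℝ)| := by
          refine Finset.sum_le_sum (fun q hq => ?_)
          rw [mem_Icc] at hq
          rw [liouvilleSlice_eq_liouville_mul_sum_progression x hq.1, abs_mul]
          calc |(liouville q : ℝ)| * |∑ n ∈ (Ioc h (⌊x⌋₊ + h)).filter (fun n => n ≡ h [MOD q]),
                  Λ n * (liouville (n - h) : ℝ)|
              ≤ 1 * |∑ n ∈ (Ioc h (⌊x⌋₊ + h)).filter (fun n => n ≡ h [MOD q]),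
                  Λ n * (liouville (n - h) : ℝ)| :=
                mul_le_mul_of_nonneg_right
                  (Literature.NumberTheory.LFunctions.LiouvilleSum.abs_liouville_le_one q)
                  (abs_nonneg _)
            _ = _ := one_mul _
      _ ≤ ∑ q ∈ Icc 1 ⌊(x + h) ^ (2 * ε)⌋₊,
            |∑ n ∈ (Ioc h (⌊x⌋₊ + h)).filter (fun n => n ≡ h [MOD q]),
              Λ n * (liouville (n - h) : ℝ)| := by
          apply Finset.sum_le_sum_of_subset_of_nonneg
          · apply Finset.Icc_subset_Icc_right
            apply Nat.floor_le_floor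
            exact Real.rpow_le_rpow hx (by linarith) (by positivity)
          · intro _ _ _
            exact abs_nonneg _
  -- asymptotics of the shifted comparison function
  have h1 : (fun x : ℝ => GT (x + h)) =o[atTop] fun x : ℝ => (x + h) / Real.log (x + h) ^ 5 :=
    hT.comp_tendsto (tendsto_atTop_add_const_right atTop (h : ℝ) tendsto_id)
  have h2 : (fun x : ℝ => (x + h) / Real.log (x + h) ^ 5) =O[atTop] fun x : ℝ => x / Real.log x ^ 5 := by
    refine IsBigO.of_bound 2 ?_
    filter_upwards [eventually_ge_atTop (max 3 (h : ℝ))] with x hx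
    have hx3 : (3 : ℝ) ≤ x := le_trans (le_max_left _ _) hx
    have hxh : (h : ℝ) ≤ x := le_trans (le_max_right _ _) hx
    have hlog1 : 1 ≤ Real.log x := Literature.NumberTheory.LFunctions.LiouvilleSum.one_le_log hx3
    have hL0 : 0 < Real.log x := by linarith
    have hloghx : Real.log x ≤ Real.log (x + h) := Real.log_le_log (by linarith) (by linarith)
    rw [Real.norm_of_nonneg (div_nonneg (by linarith) (pow_nonneg (hL0.le.trans hloghx) 5)),
      Real.norm_of_nonneg (div_nonneg (by linarith) (pow_nonneg hL0.le 5))]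
    calc (x + h) / Real.log (x + h) ^ 5 ≤ (2 * x) / Real.log x ^ 5 :=
          div_le_div₀ (by linarith) (by linarith) (pow_pos hL0 5) (pow_le_pow_left₀ hL0.le hloghx 5)
      _ = 2 * (x / Real.log x ^ 5) := by ring
  refine IsBigO.trans_isLittleO ?_ (h1.trans_isBigO h2)
  refine IsBigO.of_bound 1 ?_
  filter_upwards [eventually_ge_atTop (0 : ℝ)] with x hx
  rw [one_mul, Real.norm_of_nonneg (Finset.sum_nonneg (fun _ _ => abs_nonneg _)),
    Real.norm_of_nonneg (Finset.sum_nonneg (fun _ _ => abs_nonneg _))]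
  exact hle x hx

/-- **`≪`-form.** `MAvg` follows if for every `h ≥ 1` there are `ε > 0`, `A > 5` and `C`, `X₀` with
`∑_{q ≤ X^{2ε}} |∑_{h < n ≤ X, n ≡ h (mod q)} Λ(n) λ(n − h)| ≤ C X/(log X)^A` for all `X ≥ X₀` — the
shape in which `SieveToMAvg` (stmt-Parity-14274) states its target (`≪ X/(log X)^6`; any fixed
`A > 5` suffices, the trivial bound being `≍ ε X (log X)^2`). -/
theorem MAvg_of_sum_abs_vonMangoldt_mul_liouville_progressions_le
    (H : ∀ h : ℕ, 1 ≤ h → ∃ ε : ℝ, 0 < ε ∧ ∃ A : ℝ, 5 < A ∧ ∃ C X₀ : ℝ, ∀ X : ℝ, X₀ ≤ X →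
      ∑ q ∈ Icc 1 ⌊X ^ (2 * ε)⌋₊,
          |∑ n ∈ (Ioc h ⌊X⌋₊).filter (fun n => n ≡ h [MOD q]), Λ n * (liouville (n - h) : ℝ)|
        ≤ C * X / Real.log X ^ A) :
    Summit.Parity.GeneralizedHardyLittlewood.Theses.LiouvilleShiftedTables.MAvg := by
  refine MAvg_of_isLittleO_sum_abs_vonMangoldt_mul_liouville_progressions (fun h hh => ?_)
  obtain ⟨ε, hε, A, hA, C, X₀, hC⟩ := H h hh
  refine ⟨ε, hε, ?_⟩
  have hA5 : 0 < A - 5 := by linarith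
  -- `C (log X)^{-(A-5)} → 0`
  have hu : Tendsto (fun X : ℝ => C * Real.log X ^ (-(A - 5))) atTop (nhds 0) := by
    have t := ((tendsto_rpow_neg_atTop hA5).comp Real.tendsto_log_atTop).const_mul C
    rw [mul_zero] at t
    exact t
  have hlo : (fun X : ℝ => X / Real.log X ^ 5 * (C * Real.log X ^ (-(A - 5))))
      =o[atTop] fun X : ℝ => X / Real.log X ^ 5 := by
    have h4 := (isBigO_refl (fun X : ℝ => X / Real.log X ^ 5) atTop).mul_isLittleO
      ((isLittleO_one_iff ℝ).mpr hu)
    simpa only [mul_one] using h4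
  refine IsBigO.trans_isLittleO ?_ hlo
  refine IsBigO.of_bound 1 ?_
  filter_upwards [eventually_ge_atTop X₀, eventually_ge_atTop (3 : ℝ)] with X hX hX3
  have hL1 : 1 ≤ Real.log X := Literature.NumberTheory.LFunctions.LiouvilleSum.one_le_log hX3
  have hL : 0 < Real.log X := by linarith
  have hLA : Real.log X ^ A = Real.log X ^ (A - 5) * Real.log X ^ 5 := by
    rw [← Real.rpow_natCast _ 5, ← Real.rpow_add hL]
    norm_num
  have hne : Real.log X ^ (A - 5) ≠ 0 := (Real.rpow_pos_of_pos hL _).ne'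
  have hne5 : Real.log X ^ 5 ≠ 0 := pow_ne_zero 5 hL.ne'
  have heq : X / Real.log X ^ 5 * (C * Real.log X ^ (-(A - 5))) = C * X / Real.log X ^ A := by
    rw [Real.rpow_neg hL.le, hLA]
    field_simp
  rw [one_mul, Real.norm_of_nonneg (Finset.sum_nonneg (fun _ _ => abs_nonneg _)), heq]
  exact (hC X hX).trans (Real.le_norm_self _)

end Summit.Parity.GeneralizedHardyLittlewood.Theorems.MAvg
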